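import Mathlib
import Summits.ValiantsHypothesis.ValiantsHypothesis.Theorems.BarrierLeverPartitionMinorsHitByVPHiddenStatesMatchingPrep
import Summits.ValiantsHypothesis.ValiantsHypothesis.Theorems.BarrierLeverPartitionMinorsHitByVPSimplexJoinUniform

/-!
# Route BarrierLever — item `PartitionMinorsHitByVP` (stmt-ValiantsHypothesis-19717), line `hidden_states`:
# BLOCK + REST — the greedy piece cut as a composition theorem

Helper file (`--supports stmt-ValiantsHypothesis-19717`; cell valiant-natproofs, rung V4, 𝒟-side door (c), line `hidden_states`;
prover seat val-np-p3 gen 20; seat memo MEMO-blockpeeling-valnp3-g20 §3, §12). Definition-free. Closes NO item.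

THE THEOREM (`GreedyCut.exists_table_of_block_rest`). A zero-base piece with columns `cols : Fin r → Finset (Fin K)` (column `k` is
the point `Σ_{q ∈ cols k} g_q`), a set `B` of BLOCK STATES such that every column lies inside `B` or avoids `B`, and an injective row
family `ℛ` of subsets of `Fin h`. Let `P = {k : cols k ⊆ B}` be the block columns. IF
* (BLOCK HAS A BASE) for SOME block table the `P`-columns have a base on the rows `ℛ` (`GreedyCut.IsBase`: `|P|` rows on which they
  are linearly independent — i.e. full column rank), and
* (REST IS GOOD EVERYWHERE) the remaining columns have, for EVERY injective row family of the complementary size, SOME table with a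
  nonsingular configuration matrix,
THEN some table makes the whole configuration matrix `[∏_{a ∈ ℛ i} Σ_{q ∈ cols k} g_q a]` nonsingular.
Proof = the greedy cut of `…HiddenStatesGreedyCut` (`exists_rowScale_det_ne_zero_of_bases`: scale the block states by `D_c`, the
`c`-expansion of `det` runs over the bases of `P` with binary row weights, the lightest base is unique by matroid exchange) + one common
rest table for all complements (`PairBlock.exists_common_table`) + the splitting plumbing of `…HiddenStatesMatchingPrep`.

USE. With `B₂`-blocks (`{q}, {q,q'}` over `b` block states) and free singleton rest (generic points, always good) this says: the
node-#1-LEGAL piece «origin + b cheap states + F free states, threshold 2» is UNIFORM as soon as the tied secant configuration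
`{g_q, g_q + g_q'}` has full column rank on every row family (hypothesis BP(2, b, F) of the memo, §12–§13; census kit j330545:
no rank defect for b ≥ 2h at h = 10, 12 even with F = 0; defects for h < b < 2h on ball-like rows until F ≈ C(b,2)/4).
WHAT THIS IS NOT: BP is not proved here; item 19717 stays OPEN; nothing on crux 14610 or VP ≠ VNP.
-/

set_option linter.dupNamespace false

namespace Summit.ValiantsHypothesis.ValiantsHypothesis.Theorems.BarrierLever.HiddenStates

open Finset Matrix

noncomputable section

namespace GreedyCut

open PairBlock Matching

variable {h K r : ℕ}

/-- `IsBase` only depends on the `P`-columns of the matrix. -/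
theorem isBase_congr {N N' : Matrix (Fin r) (Fin r) ℂ} {P R : Finset (Fin r)} (hNN' : ∀ i, ∀ k ∈ P, N i k = N' i k)
    (hB : IsBase N P R) : IsBase N' P R := by
  have hrow : rowVec N' P = rowVec N P := by
    funext i; funext k
    exact (hNN' i k k.2).symm
  refine ⟨hB.1, ?_⟩
  rw [hrow]
  exact hB.2

/-- **BLOCK + REST (the greedy piece cut as a composition theorem).** See the module docstring. -/
theorem exists_table_of_block_rest (ℛ : Fin r → Finset (Fin h)) (hℛ : Function.Injective ℛ)
    (cols : Fin r → Finset (Fin K)) (B : Finset (Fin K)) (hB : ∀ k, cols k ⊆ B ∨ Disjoint (cols k) B)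
    {n n' : ℕ} (hn : (Finset.univ.filter fun k => cols k ⊆ B).card = n)
    (hn' : (Finset.univ.filter fun k => cols k ⊆ B)ᶜ.card = n')
    (hblock : ∃ gB : Fin K → Fin h → ℂ, ∃ R, IsBase (cfgMat ℛ cols gB) (Finset.univ.filter fun k => cols k ⊆ B) R)
    (hrest : ∀ v : Fin n' → Finset (Fin h), Function.Injective v →
      ∃ g : Fin K → Fin h → ℂ,
        (cfgMat v (fun y => cols ((Finset.univ.filter fun k => cols k ⊆ B)ᶜ.orderEmbOfFin hn' y)) g).det ≠ 0) :
    ∃ g : Fin K → Fin h → ℂ, (cfgMat ℛ cols g).det ≠ 0 := by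
  classical
  set P : Finset (Fin r) := Finset.univ.filter fun k => cols k ⊆ B with hPdef
  have hmemP : ∀ k, k ∈ P ↔ cols k ⊆ B := by intro k; simp [hPdef]
  have hPc : Pᶜ.card = n' := hn'
  -- outside `P` the columns avoid `B`
  have havoid : ∀ k, k ∉ P → ∀ q ∈ cols k, q ∉ B := by
    intro k hk q hq hqB
    rcases hB k with h1 | h2
    · exact hk ((hmemP k).mpr h1)
    · exact Finset.disjoint_left.mp h2 hq hqB
  -- one rest table good for every complement of `n` rows
  set colsRest : Fin n' → Finset (Fin K) := fun y => cols (Pᶜ.orderEmbOfFin hPc y) with hcolsRest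
  let T := {R : Finset (Fin r) // R.card = n}
  have hRc : ∀ R : T, (R.1)ᶜ.card = n' := fun R => by
    rw [Finset.card_compl, Fintype.card_fin, R.2, ← hn', Finset.card_compl, Fintype.card_fin, hn]
  set fam : T → (Fin n' → Finset (Fin h)) := fun R y => ℛ ((R.1)ᶜ.orderEmbOfFin (hRc R) y) with hfam
  have hgoodR : ∀ R : T, ∃ g : Fin K → Fin h → ℂ, (cfgMat (fam R) colsRest g).det ≠ 0 := by
    intro R
    refine hrest (fam R) (fun y y' hyy' => ?_)
    exact ((R.1)ᶜ.orderEmbOfFin (hRc R)).injective (hℛ hyy')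
  obtain ⟨gR, hgR⟩ := exists_common_table fam colsRest hgoodR
  obtain ⟨gB, R₀, hR₀⟩ := hblock
  -- the combined table: block states from `gB`, the others from `gR`
  set g : Fin K → Fin h → ℂ := fun q a => if q ∈ B then gB q a else gR q a with hgdef
  set N := cfgMat ℛ cols g with hN
  set wt : Fin r → ℕ := fun i => ∑ a ∈ ℛ i, 2 ^ (a : ℕ) with hwt
  have hwtinj : Function.Injective wt := SimplexJoin.binaryWeight_injective ℛ hℛ
  have hsum_in : ∀ k, k ∈ P → ∀ a, (∑ q ∈ cols k, g q a) = ∑ q ∈ cols k, gB q a := by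
    intro k hk a
    refine Finset.sum_congr rfl fun q hqk => ?_
    have hqB : q ∈ B := (hmemP k).mp hk hqk
    simp [hgdef, hqB]
  have hsum_out : ∀ k, k ∉ P → ∀ a, (∑ q ∈ cols k, g q a) = ∑ q ∈ cols k, gR q a := by
    intro k hk a
    refine Finset.sum_congr rfl fun q hqk => ?_
    have hqB : q ∉ B := havoid k hk q hqk
    simp [hgdef, hqB]
  -- (hex): the base of the block table is a base of `N`
  have hex : ∃ R, IsBase N P R := by
    refine ⟨R₀, isBase_congr (fun i k hk => ?_) hR₀⟩
    simp only [hN, cfgMat, Matrix.of_apply]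
    exact Finset.prod_congr rfl fun a _ => (hsum_in k hk a).symm
  have hPcard : P.card = n := hn
  -- (hrest): every base has a nonsingular block-zeroed matrix
  have hrest' : ∀ R, IsBase N P R → (blockZero N R P).det ≠ 0 := by
    intro R hBR
    have hRcard : R.card = n := hBR.1.trans hPcard
    have hRcn : Rᶜ.card = n' := hRc ⟨R, hRcard⟩
    obtain ⟨er, herl, herr⟩ := exists_splitEquiv R hRcard hRcn
    obtain ⟨ec, hecl, hecr⟩ := exists_splitEquiv P hPcard hPc
    refine det_blockZero_ne_zero N P R er ec
      (mem_iff_of_splitEquiv R hRcard hRcn er herl herr) (mem_iff_of_splitEquiv P hPcard hPc ec hecl hecr) ?_ ?_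
    · have hA := det_ne_zero_of_isBase N P R hBR (R.orderIsoOfFin hRcard).toEquiv (P.orderIsoOfFin hPcard).toEquiv
      have hmat : (Matrix.of fun x x' : Fin n => N (er (Sum.inl x)) (ec (Sum.inl x'))) =
          Matrix.of fun x x' : Fin n =>
            N ((R.orderIsoOfFin hRcard).toEquiv x : R) ((P.orderIsoOfFin hPcard).toEquiv x' : P) := by
        refine Matrix.ext fun x x' => ?_
        simp only [Matrix.of_apply, herl, hecl]
        rfl
      rw [hmat]; exact hA
    · have hmat : (Matrix.of fun y y' : Fin n' => N (er (Sum.inr y)) (ec (Sum.inr y'))) =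
          cfgMat (fam ⟨R, hRcard⟩) colsRest gR := by
        refine Matrix.ext fun y y' => ?_
        simp only [Matrix.of_apply, herr, hecr, hN, cfgMat, hfam, hcolsRest]
        refine Finset.prod_congr rfl fun a _ => ?_
        exact hsum_out _ (Finset.mem_compl.mp (Pᶜ.orderEmbOfFin_mem hPc y')) a
      rw [hmat]
      exact hgR ⟨R, hRcard⟩
  -- the greedy cut, realised by scaling the block states
  obtain ⟨c, hc⟩ := exists_rowScale_det_ne_zero_of_bases N P wt hwtinj hex hrest'
  refine ⟨fun q a => if q ∈ B then c ^ (2 ^ (a : ℕ)) * g q a else g q a, ?_⟩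
  have hmat : (cfgMat ℛ cols fun q a => if q ∈ B then c ^ (2 ^ (a : ℕ)) * g q a else g q a) = rowScale N P wt c := by
    refine Matrix.ext fun x k => ?_
    simp only [cfgMat, rowScale, Matrix.of_apply, hN]
    by_cases hk : k ∈ P
    · rw [if_pos hk]
      have hin : ∀ q ∈ cols k, q ∈ B := fun q hqk => (hmemP k).mp hk hqk
      have hfac : ∀ a : Fin h, (∑ q ∈ cols k, (if q ∈ B then c ^ (2 ^ (a : ℕ)) * g q a else g q a)) =
          c ^ (2 ^ (a : ℕ)) * ∑ q ∈ cols k, g q a := by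
        intro a
        rw [Finset.mul_sum]
        exact Finset.sum_congr rfl fun q hqk => by rw [if_pos (hin q hqk)]
      rw [Finset.prod_congr rfl fun a _ => hfac a, Finset.prod_mul_distrib, Finset.prod_pow_eq_pow_sum]
    · rw [if_neg hk]
      refine Finset.prod_congr rfl fun a _ => Finset.sum_congr rfl fun q hqk => ?_
      rw [if_neg (havoid k hk q hqk)]
  rw [hmat]
  exact hc

end GreedyCut

end

end Summit.ValiantsHypothesis.ValiantsHypothesis.Theorems.BarrierLever.HiddenStates
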